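import Summits.CriticalPhenomena.Ising3DConformalLimit.Theses.SubPtolemyInterlacing
import Literature.Probability.LatticeModels.CriticalUrsellFourSign
import Literature.Probability.LatticeModels.CriticalAxisRatioRegularity
import HarnessLib

/-!
# Line `Sketch` for the crux `SubPtolemyInterlacing.Interlacing` (stmt-CriticalPhenomena-15702) — stub `stub_boxSwitching`

The box defect identity (ADC21 (3.11) in a free box, tree theorem `connectedFour_free_box_eq`, applied to the
CROSSING pairing): `S₄^L = P₁^L + P₂^L + P₃^L - 2 P₂^L · 𝐏^{x₁x₃,x₂x₄}_{Λ_L}[x₁ ↔ x₂]`.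

Helper file of the line `Sketch` (lead skeleton `Cruxes/Interlacing/Lines/Sketch.lean`): proves the registered stub
`stub_boxSwitching` verbatim (name + signature). No definitions, no named facts, no sorry.
-/

noncomputable section

namespace Summit.CriticalPhenomena.Ising3DConformalLimit.Cruxes.Interlacing.Sketch

open Filter MeasureTheory
open scoped symmDiff Topology
open Literature.Probability.LatticeModels Literature.Probability.Percolation

/-- **Stub `stub_boxSwitching`** of the line `Sketch` (crux stmt-CriticalPhenomena-15702): The box defect identity (ADC21 (3.11) in a free box, tree theorem `connectedFour_free_box_eq`, applied to the CROSSING pairing): `S₄^L = P₁^L + P₂^L + P₃^L - 2 P₂^L · 𝐏^{x₁x₃,x₂x₄}_{Λ_L}[x₁ ↔ x₂]`. -/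
theorem stub_boxSwitching : ∀ L a b c : ℕ, a + b + c ≤ L →
    isingExpect (zdGraph 3) (box 3 L) (criticalBeta 3) 0 .free
          (spinMonomial ![(Pi.single 0 ((0 : ℕ) : ℤ)), (Pi.single 0 ((a : ℕ) : ℤ)), (Pi.single 0 ((a + b : ℕ) : ℤ)), (Pi.single 0 ((a + b + c : ℕ) : ℤ))]) =
      isingTwoPoint (zdGraph 3) (box 3 L) (criticalBeta 3) 0 .free (Pi.single 0 ((0 : ℕ) : ℤ)) (Pi.single 0 ((a : ℕ) : ℤ)) *
            isingTwoPoint (zdGraph 3) (box 3 L) (criticalBeta 3) 0 .free (Pi.single 0 ((a + b : ℕ) : ℤ)) (Pi.single 0 ((a + b + c : ℕ) : ℤ)) +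
        isingTwoPoint (zdGraph 3) (box 3 L) (criticalBeta 3) 0 .free (Pi.single 0 ((0 : ℕ) : ℤ)) (Pi.single 0 ((a + b : ℕ) : ℤ)) *
            isingTwoPoint (zdGraph 3) (box 3 L) (criticalBeta 3) 0 .free (Pi.single 0 ((a : ℕ) : ℤ)) (Pi.single 0 ((a + b + c : ℕ) : ℤ)) +
        isingTwoPoint (zdGraph 3) (box 3 L) (criticalBeta 3) 0 .free (Pi.single 0 ((0 : ℕ) : ℤ)) (Pi.single 0 ((a + b + c : ℕ) : ℤ)) *
            isingTwoPoint (zdGraph 3) (box 3 L) (criticalBeta 3) 0 .free (Pi.single 0 ((a : ℕ) : ℤ)) (Pi.single 0 ((a + b : ℕ) : ℤ)) -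
        2 * (isingTwoPoint (zdGraph 3) (box 3 L) (criticalBeta 3) 0 .free (Pi.single 0 ((0 : ℕ) : ℤ)) (Pi.single 0 ((a + b : ℕ) : ℤ)) *
            isingTwoPoint (zdGraph 3) (box 3 L) (criticalBeta 3) 0 .free (Pi.single 0 ((a : ℕ) : ℤ)) (Pi.single 0 ((a + b + c : ℕ) : ℤ))) *
          (sourcedDoubleCurrentLaw 3 L (criticalBeta 3) ({(Pi.single 0 ((0 : ℕ) : ℤ))} ∆ {(Pi.single 0 ((a + b : ℕ) : ℤ))})
            ({(Pi.single 0 ((a : ℕ) : ℤ))} ∆ {(Pi.single 0 ((a + b + c : ℕ) : ℤ))})).real (openConn (Pi.single 0 ((0 : ℕ) : ℤ)) (Pi.single 0 ((a : ℕ) : ℤ))) := by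
  intro L a b c h
  -- the four axis points lie in the box `Λ_L`
  have hmem : ∀ k : ℕ, k ≤ L → (Pi.single 0 (k : ℤ) : Site 3) ∈ box 3 L := by
    intro k hk
    rw [mem_box]
    intro i
    by_cases hi : i = 0
    · subst hi
      simp only [Pi.single_eq_same]
      omega
    · simp [hi]
  have h₁ := hmem 0 (Nat.zero_le L)
  have h₂ := hmem a (by omega)
  have h₃ := hmem (a + b) (by omega)
  have h₄ := hmem (a + b + c) h
  -- ADC21 (3.11) in the box for the crossing pairing `(x, y, z, t) = (x₁, x₃, x₂, x₄)`
  have key := connectedFour_free_box_eq (d := 3) L (criticalBeta_nonneg 3) h₁ h₃ h₂ h₄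
  set x₁ : Site 3 := (Pi.single 0 ((0 : ℕ) : ℤ) : Site 3) with hx₁
  set x₂ : Site 3 := (Pi.single 0 ((a : ℕ) : ℤ) : Site 3) with hx₂
  set x₃ : Site 3 := (Pi.single 0 ((a + b : ℕ) : ℤ) : Site 3) with hx₃
  set x₄ : Site 3 := (Pi.single 0 ((a + b + c : ℕ) : ℤ) : Site 3) with hx₄
  -- the four-point function is the expectation of the (permutation-invariant) spin monomial
  have hfour : nPoint (isingMeasure (zdGraph 3) (box 3 L) (criticalBeta 3) 0 .free) spinAt
      ![x₁, x₃, x₂, x₄] =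
      isingExpect (zdGraph 3) (box 3 L) (criticalBeta 3) 0 .free (spinMonomial ![x₁, x₂, x₃, x₄]) := by
    simp only [nPoint, isingExpect, spinMonomial]
    congr 1
    funext s
    simp only [Fin.prod_univ_four, Matrix.cons_val_zero, Matrix.cons_val_one, Matrix.cons_val]
    ring
  -- the two-point function of the Gibbs measure is `isingTwoPoint`
  have hpair : ∀ u v : Site 3,
      twoPoint (isingMeasure (zdGraph 3) (box 3 L) (criticalBeta 3) 0 .free) spinAt u v =
        isingTwoPoint (zdGraph 3) (box 3 L) (criticalBeta 3) 0 .free u v := fun _ _ => rfl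
  -- symmetry of the two-point function
  have hsymm : ∀ u v : Site 3, isingTwoPoint (zdGraph 3) (box 3 L) (criticalBeta 3) 0 .free u v =
      isingTwoPoint (zdGraph 3) (box 3 L) (criticalBeta 3) 0 .free v u := by
    intro u v
    simp only [isingTwoPoint, isingExpect, spinPair]
    congr 1
    funext s
    ring
  rw [connectedFour, hfour] at key
  simp only [Matrix.cons_val_zero, Matrix.cons_val_one, Matrix.cons_val, hpair] at key
  rw [hsymm x₃ x₂] at key
  linear_combination key

end Summit.CriticalPhenomena.Ising3DConformalLimit.Cruxes.Interlacing.Sketch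

end
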